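import Literature.Geometry.Lorentzian.ConformalEquationAsymptoticsThree
import Literature.Geometry.Lorentzian.RicciVariationLemma33Family
import Literature.Geometry.Lorentzian.WeakSolutionRegularity
import Literature.Analysis.Distribution.EllipticRegularityProofs
import HarnessLib

/-!
# Lemma 3.2 along the Ricci variation `ds²_t = ds² + t Ric`: existence of the conformal factors
# (Schoen–Yau 1979, proof of Thm. 2, pp. 72–74)

Schoen–Yau, Comm. Math. Phys. 65 (1979), p. 73: *"For `t` sufficiently small, `ds²_t` is
asymptotically flat by (1.2), and `(∫_N |R_t|^{3/2} √g_t dx)^{2/3} < ε₀` … Thus, we can apply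
Lemma 3.3 to get a function `φ_t` so that `φ_t⁴ ds²_t` is scalar flat and asymptotically flat."*
Lemma 3.3 is Lemma 3.2 for `f = h = R_t/8` and `φ_t = 1 + v_t` ((3.22)–(3.23)). This file proves
the **existence** of these factors — the hypothesis `hsol` of
`exists_ricciVariation_negativeMass_of_massZero_of_conformalFactor_exists`
(`RicciVariationLemma33Family.lean`), and with it the named fact
`exists_ricciVariation_negativeMass_of_massZero` (`PositiveMassRigidity.lean`):

* `AFEnd.ricciFamily_conformalFactor_exists` — for `|t|` small there are `φ_t ∈ C^∞(X)` and `A_t`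
  with `Δ_t φ_t = R_t φ_t/8` and `φ_t = 1 + A_t/r + O₂(r⁻²)` in the chart of the end:
  the uniform Sobolev inequality of the family (`exists_uniform_constants_ricciFamily`, Lemma 3.1),
  `|R_t| ≤ |t| K (1 + r)⁻⁴` (`exists_abs_scalarCurvature_ricciFamily_sub_le`) giving the
  integrability of `|R_t/8|^{3/2}, |R_t/8|^{6/5}` and the smallness `θ_t < 1`, the smooth `L⁶`
  solution `v_t` of `Δ_t v − (R_t/8) v = R_t/8` (`exists_smooth_solution_of_sobolev`,
  `WeakSolutionRegularity.lean`, with Folland's Cor. (6.34) `Folland1995_cor634_holds`), and the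
  expansion `v̂_t = A_t/r + O₂(r⁻²)` on the `O₃(r⁻²)` end of `ds²_t`
  (`endValue_expansion_of_solution_three`);
* `exists_ricciVariation_negativeMass_of_massZero_holds'` — the named fact, from
  `exists_ricciVariation_negativeMass_of_massZero_of_conformalFactor_exists`.

Everything here is proved; nothing is defined and no named fact is introduced.

## References

* R. Schoen, S.-T. Yau, *On the proof of the positive mass conjecture in general relativity*,
  Comm. Math. Phys. 65 (1979) 45–76, Lemma 3.2 (p. 64), Lemma 3.3 and (3.22)–(3.23) (pp. 71–72),
  proof of Thm. 2 (pp. 72–74). [SchoenYauPMT1979]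
* G. B. Folland, *Introduction to Partial Differential Equations*, 2nd ed. (1995), Cor. (6.34).
  [Folland2020]
-/

noncomputable section

open Set Function Filter Metric Bornology Asymptotics MeasureTheory Measure TopologicalSpace
  Manifold Bundle
open scoped Topology Manifold ContDiff ENNReal

namespace Literature.Geometry.Lorentzian

open Literature.Geometry.Riemannian PseudoRiemannianMetric

namespace AFEnd

variable {X : Type} [TopologicalSpace X] [ChartedSpace E3 X] [IsManifold (𝓡 3) ∞ X]
  [T2Space X] [SecondCountableTopology X] [LocallyCompactSpace X] [ConnectedSpace X]
  [MeasurableSpace X] [BorelSpace X]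
  (e : AFEnd X) (D : InitialDataSet (𝓡 3) X)

set_option maxHeartbeats 1600000 in
/-- **Existence of the conformal factors of Lemma 3.3 along `ds²_t = ds² + t Ric`** (Schoen–Yau
1979, p. 73 with Lemma 3.2 and (3.22)–(3.23)): on one-ended strongly asymptotically flat data
(`h − δ = o₅(r⁻²)`) with `R ≡ 0`, for `|t|` small there are `φ_t ∈ C^∞(X)` and `A_t ∈ ℝ` with
`Δ_t φ_t = R_t φ_t / 8` and `‖∂^m(φ̂_t − (1 + A_t/r))‖ = O(r^{−2−m})` for `m ≤ 2` in the chart of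
the end. [cite: SchoenYauPMT1979, Lemma 3.2 (p. 64), (3.22)–(3.23) (p. 71), proof of Thm. 2 (p. 73)] -/
theorem ricciFamily_conformalFactor_exists [D.metric.HasLeviCivita]
    (haf : e.IsStronglyAsymptoticallyFlatWith D 0 2 0 5 0) (hsole : e.IsSoleEnd)
    (hR0 : ∀ x : X, D.metric.scalarCurvature x = 0) {τ : ℝ} (hτ : 0 < τ)
    (Dt : ℝ → InitialDataSet (𝓡 3) X)
    (hval : ∀ t : ℝ, |t| < τ → ∀ (x : X) (v w : TangentSpace (𝓡 3) x),
      (Dt t).metric.val x v w = D.metric.val x v w + t * D.metric.ricci x v w) :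
    ∃ τ₀ : ℝ, 0 < τ₀ ∧ τ₀ ≤ τ ∧ ∀ t : ℝ, |t| < τ₀ →
      ∃ (φ : X → ℝ) (A : ℝ), ContMDiff (𝓡 3) 𝓘(ℝ) ∞ φ ∧
        (∀ x, haveI := (Dt t).metric.hasLeviCivita
          (Dt t).metric.dalembertian φ x = (Dt t).scalarCurvatureFn x * φ x / 8) ∧
        ∀ m : ℕ, m ≤ 2 →
          (fun x ↦ ‖iteratedFDeriv ℝ m (fun y ↦ endValue e φ y - (1 + A / ‖y‖)) x‖)
            =O[cobounded E3] fun x ↦ ‖x‖ ^ (-2 - m : ℝ) := by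
  classical
  haveI : SigmaCompactSpace X := inferInstance
  set μ : Measure X := riemannianMeasure D.h with hμ
  -- uniform constants and the global curvature bound
  obtain ⟨τ₁, C, c₁, hτ₁, hτ₁τ, hC0, -, hc₁, -, hunif⟩ :=
    e.exists_uniform_constants_ricciFamily D haf hsole hτ Dt hval
  obtain ⟨τ₂, K, hτ₂, hτ₂τ, hK0, hglob⟩ :=
    e.exists_abs_scalarCurvature_ricciFamily_sub_le D haf hsole hτ Dt hval
  have hAF : e.IsMetricAsymptoticallyFlat D 2 :=
    AFEnd.IsStronglyAsymptoticallyFlatWith.isMetricAsymptoticallyFlat_of_massZero e D haf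
      (by norm_num)
  have hH5 : IsBigOSmooth 5 (-2) fun y ↦ hCoeff e D y - (innerSL ℝ : E3 →L[ℝ] E3 →L[ℝ] ℝ) :=
    e.isBigOSmooth_hCoeff_sub_innerSL D haf
  have hRic : IsBigOSmooth 3 (-2 - 2) (ricciCoeff e D) :=
    e.isBigOSmooth_ricciCoeff D (k := 3) (β := 2) hH5 two_pos
  set J₂ : ℝ := ∫ x, (1 + ‖e.coord x‖) ^ (-(4 * (3 / 2 : ℝ))) ∂μ with hJ₂
  have hJ₂0 : 0 ≤ J₂ := integral_nonneg fun x ↦ Real.rpow_nonneg (by positivity) _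
  clear_value J₂
  set A₀ : ℝ := c₁ * (K / 8) * (2 * J₂) ^ (2 / 3 : ℝ) with hA₀
  have hA₀0 : 0 ≤ A₀ := by positivity
  set τ₀ : ℝ := min (min τ₁ τ₂) (1 / (2 * (A₀ + 1))) with hτ₀
  have hτ₀0 : 0 < τ₀ := lt_min (lt_min hτ₁ hτ₂) (by positivity)
  refine ⟨τ₀, hτ₀0, ((min_le_left _ _).trans (min_le_left _ _)).trans hτ₁τ, fun t ht ↦ ?_⟩
  have ht₁ : |t| < τ₁ := ht.trans_le ((min_le_left _ _).trans (min_le_left _ _))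
  have ht₂ : |t| < τ₂ := ht.trans_le ((min_le_left _ _).trans (min_le_right _ _))
  have htτ : |t| < τ := ht₁.trans_le hτ₁τ
  have htA : A₀ * |t| ≤ 1 / 2 := by
    have h1 : |t| ≤ 1 / (2 * (A₀ + 1)) := ht.le.trans (min_le_right _ _)
    have h2 : A₀ * |t| ≤ A₀ * (1 / (2 * (A₀ + 1))) := mul_le_mul_of_nonneg_left h1 hA₀0
    have h3 : A₀ * (1 / (2 * (A₀ + 1))) ≤ 1 / 2 := by
      rw [mul_one_div, div_le_iff₀ (by positivity)]
      linarith
    exact h2.trans h3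
  obtain ⟨-, -, -, hμle, -, hS⟩ := hunif t ht₁
  haveI := (Dt t).metric.hasLeviCivita
  -- the end of `ds²_t`: `O₃(r⁻²)` and asymptotically flat to second order
  have hASt : IsAsymptoticallySchwarzschild e (Dt t) 0 2 :=
    e.isAsymptoticallySchwarzschild_of_metric_eq_add_ricci D haf (hval t htτ)
  have hAFt : e.IsMetricAsymptoticallyFlat (Dt t) 2 := hASt.isMetricAsymptoticallyFlat_two le_rfl
  have hH3t : IsBigOSmooth 3 (-2) fun y ↦ hCoeff e (Dt t) y - (innerSL ℝ : E3 →L[ℝ] E3 →L[ℝ] ℝ) := by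
    have hsum : IsBigOSmooth 3 (-2) fun y ↦
        (hCoeff e D y - (innerSL ℝ : E3 →L[ℝ] E3 →L[ℝ] ℝ)) + t • ricciCoeff e D y :=
      (hH5.of_le (by norm_num)).add ((hRic.mono (by norm_num)).const_smul t)
    refine hsum.congr fun y ↦ ?_
    rw [e.hCoeff_eq_add_ricciCoeff D (hval t htτ) y]
    abel
  set μt : Measure X := riemannianMeasure (Dt t).h with hμt
  set R : X → ℝ := (Dt t).scalarCurvatureFn with hR
  have hReq : ∀ x, R x = (Dt t).metric.scalarCurvature x := fun x ↦ (Dt t).scalarCurvatureFn_eq x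
  have hRs : ContMDiff (𝓡 3) 𝓘(ℝ, ℝ) ∞ R :=
    (Dt t).metric.contMDiff_scalarCurvature.congr fun x ↦ hReq x
  -- `|R_t| ≤ |t| K W`
  have hR00 : D.scalarCurvatureFn = fun _ ↦ 0 := by
    funext x
    rw [D.scalarCurvatureFn_eq]
    exact hR0 x
  have hRle : ∀ x, |R x| ≤ |t| * K * (1 + ‖e.coord x‖) ^ (-4 : ℝ) := fun x ↦ by
    have h := hglob t ht₂ x
    rw [hR00, sub_zero] at h
    exact h
  -- the potential/source `f = R/8`
  set f : X → ℝ := fun x ↦ R x / 8 with hf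
  have hfs : ContMDiff (𝓡 3) 𝓘(ℝ, ℝ) ∞ f := by
    simp_rw [hf, div_eq_mul_inv]
    exact hRs.mul contMDiff_const
  have hfc : Continuous f := hfs.continuous
  have hfle : ∀ x, |f x| ≤ |t| * K * 8⁻¹ * (1 + ‖e.coord x‖) ^ (-4 : ℝ) := fun x ↦ by
    simp only [hf]
    rw [abs_div, abs_of_pos (by norm_num : (0 : ℝ) < 8)]
    have := hRle x
    rw [div_eq_mul_inv]
    nlinarith [Real.rpow_nonneg (by positivity : (0 : ℝ) ≤ 1 + ‖e.coord x‖) (-4 : ℝ)]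
  -- integrability of `|f|^p` against `dV_t` for `p = 3/2, 6/5`
  have hfp : ∀ {p : ℝ}, 3 / 4 < p → p ≤ 2 → Integrable (fun x ↦ |f x| ^ p) μt := by
    intro p hp hp2
    have hp0 : 0 ≤ p := by linarith
    have hWp : Integrable (fun x ↦ (1 + ‖e.coord x‖) ^ (-(4 * p))) μt :=
      e.integrable_one_add_norm_coord_rpow_neg_of_le D two_pos hAF hsole (by linarith) hμle
    refine (hWp.const_mul ((|t| * K * 8⁻¹) ^ p)).mono'
      ((continuous_abs.comp hfc).rpow_const fun x ↦ Or.inr hp0).aestronglyMeasurable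
      (Eventually.of_forall fun x ↦ ?_)
    rw [Real.norm_of_nonneg (Real.rpow_nonneg (abs_nonneg _) _)]
    calc |f x| ^ p ≤ (|t| * K * 8⁻¹ * (1 + ‖e.coord x‖) ^ (-4 : ℝ)) ^ p :=
          Real.rpow_le_rpow (abs_nonneg _) (hfle x) hp0
      _ = (|t| * K * 8⁻¹) ^ p * (1 + ‖e.coord x‖) ^ (-(4 * p)) := by
          rw [Real.mul_rpow (by positivity) (Real.rpow_nonneg (by positivity) _),
            ← Real.rpow_mul (by positivity)]
          ring_nf
  have hfi : Integrable (fun x ↦ |f x| ^ (3 / 2 : ℝ)) μt := hfp (by norm_num) (by norm_num)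
  have hgi : Integrable (fun x ↦ |f x| ^ (6 / 5 : ℝ)) μt := hfp (by norm_num) (by norm_num)
  -- the smallness `θ_t ≤ 1/2 < 1`
  have hcm0 : ∀ x, 0 ≤ max (-f x) 0 := fun x ↦ le_max_right _ _
  have hW32 : Integrable (fun x ↦ (1 + ‖e.coord x‖) ^ (-(4 * (3 / 2 : ℝ)))) μt :=
    e.integrable_one_add_norm_coord_rpow_neg_of_le D two_pos hAF hsole (by norm_num) hμle
  have hcmle : ∀ x, max (-f x) 0 ^ (3 / 2 : ℝ) ≤
      (|t| * K * 8⁻¹) ^ (3 / 2 : ℝ) * (1 + ‖e.coord x‖) ^ (-(4 * (3 / 2 : ℝ))) := fun x ↦ by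
    have h1 : max (-f x) 0 ≤ |t| * K * 8⁻¹ * (1 + ‖e.coord x‖) ^ (-4 : ℝ) := by
      refine max_le ?_ (by positivity)
      exact (neg_le_abs (f x)).trans (hfle x)
    calc max (-f x) 0 ^ (3 / 2 : ℝ) ≤ (|t| * K * 8⁻¹ * (1 + ‖e.coord x‖) ^ (-4 : ℝ)) ^ (3 / 2 : ℝ) :=
          Real.rpow_le_rpow (hcm0 x) h1 (by norm_num)
      _ = (|t| * K * 8⁻¹) ^ (3 / 2 : ℝ) * (1 + ‖e.coord x‖) ^ (-(4 * (3 / 2 : ℝ))) := by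
          rw [Real.mul_rpow (by positivity) (Real.rpow_nonneg (by positivity) _),
            ← Real.rpow_mul (by positivity)]
          norm_num
  have hci : Integrable (fun x ↦ max (-f x) 0 ^ (3 / 2 : ℝ)) μt := by
    refine (hW32.const_mul ((|t| * K * 8⁻¹) ^ (3 / 2 : ℝ))).mono'
      ((hfc.neg.max continuous_const).rpow_const fun x ↦ Or.inr (by norm_num)).aestronglyMeasurable
      (Eventually.of_forall fun x ↦ ?_)
    rw [Real.norm_of_nonneg (Real.rpow_nonneg (hcm0 x) _)]
    exact hcmle x
  have hNle : ∫ x, max (-f x) 0 ^ (3 / 2 : ℝ) ∂μt ≤ (|t| * K * 8⁻¹) ^ (3 / 2 : ℝ) * (2 * J₂) := by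
    have hWμ : Integrable (fun x ↦ (1 + ‖e.coord x‖) ^ (-(4 * (3 / 2 : ℝ)))) μ :=
      e.integrable_one_add_norm_coord_rpow_neg D two_pos hAF hsole (by norm_num)
    have hle2 : ∫ x, (1 + ‖e.coord x‖) ^ (-(4 * (3 / 2 : ℝ))) ∂μt ≤ 2 * J₂ := by
      calc ∫ x, (1 + ‖e.coord x‖) ^ (-(4 * (3 / 2 : ℝ))) ∂μt
          ≤ ∫ x, (1 + ‖e.coord x‖) ^ (-(4 * (3 / 2 : ℝ))) ∂(ENNReal.ofReal 2 • μ) :=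
            integral_mono_measure hμle (Eventually.of_forall fun x ↦ Real.rpow_nonneg (by positivity) _)
              (hWμ.smul_measure ENNReal.ofReal_ne_top)
        _ = 2 * J₂ := by
            rw [integral_smul_measure, ENNReal.toReal_ofReal (by norm_num : (0 : ℝ) ≤ 2), smul_eq_mul, hJ₂]
    calc ∫ x, max (-f x) 0 ^ (3 / 2 : ℝ) ∂μt
        ≤ ∫ x, (|t| * K * 8⁻¹) ^ (3 / 2 : ℝ) * (1 + ‖e.coord x‖) ^ (-(4 * (3 / 2 : ℝ))) ∂μt :=
          integral_mono hci (hW32.const_mul _) hcmle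
      _ = (|t| * K * 8⁻¹) ^ (3 / 2 : ℝ) * ∫ x, (1 + ‖e.coord x‖) ^ (-(4 * (3 / 2 : ℝ))) ∂μt :=
          integral_const_mul _ _
      _ ≤ (|t| * K * 8⁻¹) ^ (3 / 2 : ℝ) * (2 * J₂) :=
          mul_le_mul_of_nonneg_left hle2 (Real.rpow_nonneg (by positivity) _)
  have hN0 : 0 ≤ ∫ x, max (-f x) 0 ^ (3 / 2 : ℝ) ∂μt := integral_nonneg fun x ↦ Real.rpow_nonneg (hcm0 x) _
  have hθ : c₁ * (∫ x, max (-f x) 0 ^ (3 / 2 : ℝ) ∂μt) ^ (2 / 3 : ℝ) < 1 := by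
    have h1 : (∫ x, max (-f x) 0 ^ (3 / 2 : ℝ) ∂μt) ^ (2 / 3 : ℝ) ≤
        ((|t| * K * 8⁻¹) ^ (3 / 2 : ℝ) * (2 * J₂)) ^ (2 / 3 : ℝ) := Real.rpow_le_rpow hN0 hNle (by norm_num)
    have h2 : ((|t| * K * 8⁻¹) ^ (3 / 2 : ℝ) * (2 * J₂)) ^ (2 / 3 : ℝ) = |t| * K * 8⁻¹ * (2 * J₂) ^ (2 / 3 : ℝ) := by
      rw [Real.mul_rpow (Real.rpow_nonneg (by positivity) _) (by positivity),
        ← Real.rpow_mul (by positivity)]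
      norm_num
    rw [h2] at h1
    calc c₁ * (∫ x, max (-f x) 0 ^ (3 / 2 : ℝ) ∂μt) ^ (2 / 3 : ℝ)
        ≤ c₁ * (|t| * K * 8⁻¹ * (2 * J₂) ^ (2 / 3 : ℝ)) := mul_le_mul_of_nonneg_left h1 hc₁
      _ = A₀ * |t| := by simp only [hA₀]; ring
      _ ≤ 1 / 2 := htA
      _ < 1 := by norm_num
  -- the smooth `L⁶` solution of `Δ_t v − f v = f` (Lemma 3.2, existence)
  obtain ⟨v, hvs, hv6, -, hvpde⟩ :=
    exists_smooth_solution_of_sobolev (Dt t) Literature.Analysis.Distribution.Folland1995_cor634_holds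
      hc₁ hS hfs hfs hfi hθ hgi
  -- the expansion (Lemma 3.2, asymptotic half, on the `O₃(r⁻²)` end of `ds²_t`)
  have hvpde' : ∀ x, (Dt t).metric.dalembertian v x - (Dt t).metric.scalarCurvature x / 8 * v x =
      (Dt t).metric.scalarCurvature x / 8 := fun x ↦ by
    have h := hvpde x
    simp only [hf, hReq] at h
    exact h
  obtain ⟨A, hA⟩ := endValue_expansion_of_solution_three X (Dt t) e hH3t hAFt v hvs hv6 hvpde'
  -- `φ = v + 1`
  have hv2 : ContMDiff (𝓡 3) 𝓘(ℝ, ℝ) 2 v := by exact_mod_cast contMDiff_infty.1 hvs 2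
  have hΔ1 : ∀ x, (Dt t).metric.dalembertian (fun q ↦ v q + 1) x = (Dt t).metric.dalembertian v x := by
    intro x
    have hcomp : (fun q ↦ v q + 1) = (fun s : ℝ ↦ s + 1) ∘ v := rfl
    have hζ : ContDiffAt ℝ 2 (fun s : ℝ ↦ s + 1) (v x) := (contDiff_id.add contDiff_const).contDiffAt
    have hΔ := (Dt t).metric.dalembertian_real_comp (hv2 x) hζ
    have hd1 : deriv (fun s : ℝ ↦ s + 1) = fun _ ↦ 1 := by
      funext s
      rw [deriv_add_const, deriv_id'']
    have hd2 : deriv (deriv (fun s : ℝ ↦ s + 1)) (v x) = 0 := by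
      rw [hd1, deriv_const]
    rw [hcomp, hΔ, hd2, hd1, zero_mul, zero_add, one_mul]
  refine ⟨fun x ↦ v x + 1, A, hvs.add contMDiff_const, fun x ↦ ?_, fun m hm ↦ ?_⟩
  · show (Dt t).metric.dalembertian (fun q ↦ v q + 1) x = R x * (v x + 1) / 8
    rw [hΔ1 x]
    have h := hvpde x
    simp only [hf] at h
    have : (Dt t).metric.dalembertian v x = R x / 8 * v x + R x / 8 := by linarith
    rw [this]
    ring
  · refine (hA m hm).congr' ?_ EventuallyEq.rfl
    have hfar : ∀ᶠ x in cobounded E3, e.R < ‖x‖ :=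
      tendsto_norm_cobounded_atTop.eventually (eventually_gt_atTop e.R)
    filter_upwards [hfar] with x hx
    have hloc : (fun y ↦ endValue e v y - A / ‖y‖) =ᶠ[𝓝 x]
        fun y ↦ endValue e (fun q ↦ v q + 1) y - (1 + A / ‖y‖) := by
      filter_upwards [(isOpen_lt continuous_const continuous_norm).mem_nhds hx] with y hy
      rw [endValue_of_lt e _ hy, endValue_of_lt e _ hy]
      ring
    rw [(hloc.iteratedFDeriv ℝ m).eq_of_nhds]

end AFEnd

/-- **The Ricci variation produces a scalar-flat metric of negative mass** — the named fact
`exists_ricciVariation_negativeMass_of_massZero` (Schoen–Yau 1979, proof of Thm. 2, pp. 72–74),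
from the existence of the conformal factors along the family
(`AFEnd.ricciFamily_conformalFactor_exists`) and the reduction
`exists_ricciVariation_negativeMass_of_massZero_of_conformalFactor_exists` (everything else —
the family, `R'₀ = −‖Ric‖²`, Lemma 3.3 and its uniqueness clause, the differentiation of the
mass — being proved in `RicciVariation*.lean`).
[cite: SchoenYauPMT1979, §3, proof of Thm. 2 (pp. 72–74), with Lemmas 3.1–3.3] -/
theorem exists_ricciVariation_negativeMass_of_massZero_holds' :
    exists_ricciVariation_negativeMass_of_massZero :=
  exists_ricciVariation_negativeMass_of_massZero_of_conformalFactor_exists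
    fun _ _ _ _ _ _ _ _ _ _ D _ e _ Dt _ haf hsole hR0 hτ hval ↦
      e.ricciFamily_conformalFactor_exists D haf hsole hR0 hτ Dt hval

end Literature.Geometry.Lorentzian

namespace Literature.Geometry.Lorentzian

/-- **`exists_ricciVariation_negativeMass_of_massZero` is a theorem of the tree (audit alias).**
The named fact `exists_ricciVariation_negativeMass_of_massZero` (`PositiveMassRigidity.lean`):
The Ricci variation produces a scalar-flat metric of negative mass (Schoen–Yau, Comm. Math.
Phys. 65 (1979), §3, pp. 72–74). Named fact, verbatim core: … — is proved by
`exists_ricciVariation_negativeMass_of_massZero_holds'` (this file, primed name); this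
unprimed alias records the discharge under the census/audit name
`exists_ricciVariation_negativeMass_of_massZero_holds` (librarian sweep g25, pass 5c; no new
mathematics).
[cite: SchoenYauPMT1979, §3 (3.24)–(3.30), pp. 72–74, with Lemma 3.3] -/
theorem exists_ricciVariation_negativeMass_of_massZero_holds :
    exists_ricciVariation_negativeMass_of_massZero :=
  Literature.Geometry.Lorentzian.exists_ricciVariation_negativeMass_of_massZero_holds'

end Literature.Geometry.Lorentzian
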